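import Mathlib.Algebra.FreeAlgebra
import Mathlib.Data.List.GetD
import Mathlib.LinearAlgebra.Matrix.Determinant.Basic
import Literature.Computability.AlgebraicComplexity.StandardFamilies
import Literature.Computability.AlgebraicComplexity.ArithCircuitProofs
import HarnessLib

/-!
# Noncommutative arithmetic circuits: the free-algebra semantics of `ArithCircuit`, the ordered
# (Cayley) permanent and determinant (Nisan 1991 §1; Hrubeš–Wigderson–Yehudayoff 2010 §1–2;
# Arvind–Srinivasan 2010 §1–2)

Topic: `Literature/Computability/AlgebraicComplexity`. Statement-and-proof file (everything here is a
definition or a proved lemma; the named facts of HWY10 / AS10 that are STATED over these notions live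
in the sibling files `HWY10SumOfSquares.lean`, `AS10CayleyDeterminant.lean`).

NONCOMMUTATIVE CIRCUITS IN PRINT. Nisan (STOC 1991, §1) and HWY10 (§2, p.7: "a non-commutative
arithmetic circuit … computes a non-commutative polynomial in F⟨X⟩ in the obvious way; in a product gate
the order of the two children matters"), AS10 (§2: "each multiplication gate has a designated left child
and a designated right child … product in left-to-right order") all use the SAME SYNTAX as commutative
circuits and change only the SEMANTICS: variables do not commute. The tree's syntax is
`ArithCircuit k σ` (`ArithCircuit.lean`: a list of weighted-sum / product gates over operands
`var i | const c | gate j`, size = number of gates, `IsFanInTwo`); a product gate carries an operand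
LIST, i.e. an order of multiplication. This file reads that syntax in the free algebra
`FreeAlgebra k σ = k⟨σ⟩`:

* `ArithCircuit.Operand.ncEval`, `ArithCircuit.Gate.ncEval`, `ArithCircuit.ncGateValues`,
  `ArithCircuit.ncEval : ArithCircuit k σ → FreeAlgebra k σ` — clause by clause the definitions of
  `Operand.eval`, `Gate.eval`, `gateValues`, `eval` with `MvPolynomial σ k` replaced by `FreeAlgebra k σ`
  (same junk convention: an out-of-range gate reference is `0`);
* `commImage : FreeAlgebra k σ →ₐ[k] MvPolynomial σ k` (`X i ↦ X i`, letting the variables commute) and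
  the COMMUTATIVE IMAGE LEMMA `ArithCircuit.commImage_ncEval : commImage P.ncEval = P.eval` (HWY10 §1.1:
  a noncommutative circuit for `f` is in particular a commutative circuit, of the same size, for the
  commutative image of `f`);
* the ORDERED PERMANENT and DETERMINANT `ncPerPoly n = ∑_π ∏_{t<n} X_(π t, t)`,
  `ncDetPoly n = ∑_π sgn π · ∏_{t<n} X_(π t, t)` in `FreeAlgebra k (Fin n × Fin n)` with
  `commImage (ncPerPoly n) = perPoly (Fin n) k`, `commImage (ncDetPoly n) = detPoly (Fin n) k`.
  CONVENTION: the `t`-th factor is the variable in COLUMN `t` (matching the tree's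
  `perPoly = ∑_π ∏ᵢ X_(π i, i)`); HWY10's `PERM_n = ∑_π x_{1,π(1)} ⋯ x_{n,π(n)}` (p.4) and AS10's Cayley
  `Cdet_n`, `Cperm_n` (§1) are ROW-ordered — the two conventions differ by the renaming
  `x_{ij} ↦ x_{ji}`, which preserves circuit size, so every size statement transfers verbatim;
* `HasNcCircuitSizeLE f s`: some fan-in-two circuit of size `≤ s` has noncommutative value `f` — the
  complexity predicate the named facts are stated with.

The same semantics was first written summit-side (`Summits/ValiantsHypothesis/…/Theorems/NcSemantics.lean`,
identical clauses); `Theorems/NcLiteratureBridge.lean` there proves the two agree. No instances, no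
notation, no sorry.

## References

* [Nisan1991Noncommutative] N. Nisan, *Lower bounds for non-commutative computation*, STOC 1991, §1.
* [HrubesWigdersonYehudayoff2010] P. Hrubeš, A. Wigderson, A. Yehudayoff, *Non-commutative circuits and
  the sum-of-squares problem*, STOC 2010 (J. AMS 24 (2011)), §1.1, §1.3 (PERM_n), §2 (circuits, p.7).
* [ArvindSrinivasan2010] V. Arvind, S. Srinivasan, *On the hardness of the noncommutative determinant*,
  STOC 2010 (arXiv:0910.2370), §1 (Cayley determinant / permanent), §2 (circuits).
* [Burgisser2000] P. Bürgisser, *Completeness and Reduction in Algebraic Complexity Theory*, Def. 2.1,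
  (2.1)–(2.2).
-/

noncomputable section

open MvPolynomial

namespace Literature.Computability.AlgebraicComplexity

universe u v

variable {k : Type u} {σ : Type v}

/-! ## Noncommutative semantics of the circuit syntax -/

namespace ArithCircuit

section Semantics

variable [CommSemiring k]

/-- Noncommutative value of an operand against the list of nc values of the earlier gates:
`var i ↦ ι i` (free generator), `const c ↦ c · 1`, `gate j ↦ vals[j]` (junk `0` out of range) — the
clauses of `Operand.eval` read in `FreeAlgebra k σ` (Nisan 1991 §1; HWY10 §2).
[cite: Nisan1991Noncommutative, §1] -/
def Operand.ncEval (vals : List (FreeAlgebra k σ)) : Operand k σ → FreeAlgebra k σ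
  | .var i => FreeAlgebra.ι k i
  | .const c => algebraMap k (FreeAlgebra k σ) c
  | .gate j => vals.getD j 0

/-- Noncommutative value of a gate: weighted sum, resp. ORDERED product of its operands (the operand
list order is the order of multiplication; HWY10 §2 p.7, AS10 §2 "left-to-right order").
[cite: HrubesWigdersonYehudayoff2010, §2] -/
def Gate.ncEval (vals : List (FreeAlgebra k σ)) : Gate k σ → FreeAlgebra k σ
  | .sum args => (args.map fun a => a.1 • a.2.ncEval vals).sum
  | .prod args => (args.map fun u => u.ncEval vals).prod

/-- The list of nc values of a gate list (left fold, as `gateValues`). [cite: Nisan1991Noncommutative, §1] -/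
def ncGateValues (gs : List (Gate k σ)) : List (FreeAlgebra k σ) :=
  gs.foldl (fun vals g => vals ++ [g.ncEval vals]) []

/-- The NONCOMMUTATIVE POLYNOMIAL computed by a circuit: the syntax `ArithCircuit k σ` read in the free
algebra `FreeAlgebra k σ` (Nisan 1991 §1; HWY10 §2; AS10 §2). [cite: Nisan1991Noncommutative, §1] -/
def ncEval (P : ArithCircuit k σ) : FreeAlgebra k σ :=
  P.output.ncEval (ncGateValues P.gates)

/-- One step of the fold defining `ncGateValues` (definition unfolding). [cite: Nisan1991Noncommutative, §1] -/
@[simp] theorem ncGateValues_append_singleton (gs : List (Gate k σ)) (g : Gate k σ) :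
    ncGateValues (gs ++ [g]) = ncGateValues gs ++ [g.ncEval (ncGateValues gs)] := by
  simp [ncGateValues, List.foldl_append]

end Semantics

end ArithCircuit

/-! ## The commutative image -/

section CommImage

variable [CommSemiring k]

/-- The commutative image `k⟨σ⟩ →ₐ[k] k[σ]`, `ι i ↦ X i` (letting the variables commute; HWY10 §1.1 writes `f ↦ f^{(c)}`). [cite: HrubesWigdersonYehudayoff2010, §1.1] -/
def commImage : FreeAlgebra k σ →ₐ[k] MvPolynomial σ k :=
  FreeAlgebra.lift k fun i => (X i : MvPolynomial σ k)

/-- `commImage (ι i) = X i`. [cite: HrubesWigdersonYehudayoff2010, §1.1] -/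
@[simp] theorem commImage_ι (i : σ) : commImage (FreeAlgebra.ι k i) = (X i : MvPolynomial σ k) := by
  simp [commImage]

namespace ArithCircuit

/-- The commutative image of an operand's nc value is its commutative value (step of the
commutative image lemma, HWY10 §1.1). [cite: HrubesWigdersonYehudayoff2010, §1.1] -/
theorem Operand.commImage_ncEval (vals : List (FreeAlgebra k σ)) (u : Operand k σ) :
    commImage (u.ncEval vals) = u.eval (vals.map commImage) := by
  cases u with
  | var i => simp [Operand.ncEval, Operand.eval]
  | const c => simp [Operand.ncEval, Operand.eval, AlgHom.commutes, MvPolynomial.algebraMap_eq]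
  | gate j =>
    simp only [Operand.ncEval, Operand.eval_gate]
    rw [← map_zero (commImage (k := k) (σ := σ)), List.getD_map]

/-- The commutative image of a gate's nc value is its commutative value (step of the commutative
image lemma, HWY10 §1.1). [cite: HrubesWigdersonYehudayoff2010, §1.1] -/
theorem Gate.commImage_ncEval (vals : List (FreeAlgebra k σ)) (g : Gate k σ) :
    commImage (g.ncEval vals) = g.eval (vals.map commImage) := by
  cases g with
  | sum args =>
    simp [Gate.ncEval, Gate.eval, map_list_sum, List.map_map, Function.comp_def,
      Operand.commImage_ncEval]
  | prod args =>
    simp [Gate.ncEval, Gate.eval, map_list_prod, List.map_map, Function.comp_def,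
      Operand.commImage_ncEval]

/-- The commutative images of the nc gate values are the commutative gate values (step of the
commutative image lemma, HWY10 §1.1). [cite: HrubesWigdersonYehudayoff2010, §1.1] -/
theorem map_commImage_ncGateValues (gs : List (Gate k σ)) :
    (ncGateValues gs).map commImage = gateValues gs := by
  induction gs using List.reverseRecOn with
  | nil => simp [ncGateValues, gateValues]
  | append_singleton gs g ih =>
    rw [ncGateValues_append_singleton, gateValues_append_singleton, List.map_append,
      List.map_singleton, Gate.commImage_ncEval, ih]

/-- COMMUTATIVE IMAGE LEMMA: a circuit read noncommutatively and then abelianised gives the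
polynomial it computes commutatively (HWY10 §1.1: every commutative lower bound is a noncommutative
lower bound). [cite: HrubesWigdersonYehudayoff2010, §1.1] -/
theorem commImage_ncEval (P : ArithCircuit k σ) : commImage P.ncEval = P.eval := by
  rw [ncEval, Operand.commImage_ncEval, map_commImage_ncGateValues]
  rfl

/-- A circuit whose noncommutative value abelianises to `f` computes `f`. [cite: HrubesWigdersonYehudayoff2010, §1.1] -/
theorem computes_of_ncEval (P : ArithCircuit k σ) {g : FreeAlgebra k σ} (h : P.ncEval = g) :
    P.Computes (commImage g) := by
  rw [Computes, ← commImage_ncEval, h]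

end ArithCircuit

end CommImage

/-! ## The ordered permanent and determinant -/

/-- The ORDERED (Cayley, column-ordered) PERMANENT `∑_π X_(π 0,0) X_(π 1,1) ⋯ X_(π (n-1),n-1)` in the
free algebra on the `n²` matrix positions (HWY10 p.4 `PERM_n`, AS10 §1 `Cperm_n`, up to the transpose
renaming — see the module docstring). [cite: HrubesWigdersonYehudayoff2010, §1.3] -/
def ncPerPoly (k : Type u) [CommSemiring k] (n : ℕ) : FreeAlgebra k (Fin n × Fin n) :=
  ∑ π : Equiv.Perm (Fin n), (List.ofFn fun i : Fin n => FreeAlgebra.ι k (π i, i)).prod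

/-- The ORDERED (Cayley, column-ordered) DETERMINANT `∑_π sgn(π) · X_(π 0,0) ⋯ X_(π (n-1),n-1)`
(AS10 §1 `Cdet_n`, up to the transpose renaming). [cite: ArvindSrinivasan2010, §1] -/
def ncDetPoly (k : Type u) [CommRing k] (n : ℕ) : FreeAlgebra k (Fin n × Fin n) :=
  ∑ π : Equiv.Perm (Fin n), Equiv.Perm.sign π • (List.ofFn fun i : Fin n => FreeAlgebra.ι k (π i, i)).prod

/-- The commutative image of the ordered permanent is the permanent `perPoly`.
[cite: Burgisser2000, (2.2)] -/
theorem commImage_ncPerPoly (k : Type u) [CommSemiring k] (n : ℕ) :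
    commImage (ncPerPoly k n) = perPoly (Fin n) k := by
  simp [ncPerPoly, map_sum, map_list_prod, List.prod_ofFn, perPoly, Matrix.permanent,
    Matrix.mvPolynomialX]

/-- The commutative image of the ordered determinant is the determinant `detPoly`.
[cite: Burgisser2000, (2.1)] -/
theorem commImage_ncDetPoly (k : Type u) [CommRing k] (n : ℕ) :
    commImage (ncDetPoly k n) = detPoly (Fin n) k := by
  simp [ncDetPoly, map_sum, Units.smul_def, map_list_prod, List.prod_ofFn, detPoly,
    Matrix.det_apply, Matrix.mvPolynomialX]

/-! ## Noncommutative circuit size -/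

/-- `HasNcCircuitSizeLE f s`: some fan-in-two circuit with at most `s` gates has noncommutative value
`f` (the size measure of HWY10 §2 / AS10 §2 up to the constant factor between gates and edges/nodes).
[cite: HrubesWigdersonYehudayoff2010, §2] -/
def HasNcCircuitSizeLE [CommSemiring k] (f : FreeAlgebra k σ) (s : ℕ) : Prop :=
  ∃ P : ArithCircuit k σ, P.IsFanInTwo ∧ P.ncEval = f ∧ P.size ≤ s

/-- Monotonicity of the size predicate (immediate from the definition, HWY10 §2).
[cite: HrubesWigdersonYehudayoff2010, §2] -/
theorem HasNcCircuitSizeLE.mono [CommSemiring k] {f : FreeAlgebra k σ} {s t : ℕ}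
    (h : HasNcCircuitSizeLE f s) (hst : s ≤ t) : HasNcCircuitSizeLE f t := by
  obtain ⟨P, h2, hP, hs⟩ := h
  exact ⟨P, h2, hP, hs.trans hst⟩

/-- A noncommutative circuit of size `≤ s` for `f` is a commutative circuit of size `≤ s` for its
commutative image: `complexity (commImage f) ≤ s`. [cite: HrubesWigdersonYehudayoff2010, §1.1] -/
theorem HasNcCircuitSizeLE.complexity_le [CommSemiring k] {f : FreeAlgebra k σ} {s : ℕ}
    (h : HasNcCircuitSizeLE f s) : complexity (commImage f) ≤ s := by
  obtain ⟨P, h2, hP, hs⟩ := h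
  exact (ArithCircuit.complexity_le_size h2 (P.computes_of_ncEval hP)).trans hs

end Literature.Computability.AlgebraicComplexity

end
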